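import Summits.HodgeConjecture.HodgeConjecture.Theorems.F0P3cXiCentralIotaOfOrgans   -- ★ p850019 (B0): letters `S2CentralIotaLetter`, `XiCentralCharSplitLetter`; head `s2CentralIota_of_organs`
import Summits.HodgeConjecture.HodgeConjecture.Theorems.F0P3cXiCentralCharSplit      -- ★ SB5 (F0P3a-p01 (g19)): `xiCentralCharSplit : XiCentralCharSplitLetter` (O-SPLIT discharged)
import HarnessLib

/-!
# Crux `H413`, line LH1 «ZENTRUM» — (B5) CENTRAL-ι IS A THEOREM: `s2CentralIota : S2CentralIotaLetter` (weight-zero central character), unconditionally in-house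

Cell `hodgecm-mathlib` (D-0151), FLOOR 0, crux item H413 = `stmt-HodgeConjecture-24833` (`--supports`), route of record `HCCMUnconditional`; half A line LH1
(closer stub `stub_S2sharp`, #80 S2♯), «ZENTRUM» chapter of LH1-plan (g4) (memo `F0/P3c/LH1/LH1-plan/g4/G5-ZENTRUM-PRICING.v3_1.md`); seat LH1-p04 (g3), brick (B5)
(deal 2026-09-02 06:50:56Z, kept by ruling 07:07:11Z).  THEOREMS ONLY (no `def`, no instance, no notation, no named fact, no `sorry`).
HC_CM is proved only modulo the 7 printed citations (2 remaining: hLiu418 = stmt-HodgeConjecture-24832, h413 = stmt-HodgeConjecture-24833) until rung 0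
closes; this file books nothing by itself — it makes organ CENTRAL-ι of the LH1 leaf preview (`S2CentralIotaLetter`, ★ (B0) p850019) a ★ THEOREM, so that LEAF ED. 3
may replace the tree organ GLOBAL-ι^χ by the strictly smaller print organ CASIMIR-ι (desk rule «sorries non-increasing»: 3 = 3, content down).

## What is proved
* HEAD `s2CentralIota : S2CentralIotaLetter` — the ★ (B0) head `s2CentralIota_of_organs : XiCentralCharSplitLetter → S2CentralIotaLetter` applied to the ★ SB5 theorem
  `F0P3cXiCentralCharSplit.xiCentralCharSplit : XiCentralCharSplitLetter` (O-SPLIT «ZENTRUM-SPLIT», F0P3a-p01 (g19), on ★ SB2 p850029 ∕ SB3 p850057 ∕ SB4 p850051 ∕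
  FIN-SMOOTH p850020).  With O-RIGID (★ p849942), O-ARCH (★ p849968) and O-ARCHψ (★ `F0P3cCotangentArchCentreTrivial`) already consumed by name inside (B0), every organ of
  the CENTRAL-ι sub-leaf is now ★: `a + b + c = 0` for `(a,b,c) = rogTriple (ξ.pη ι) (ξ.qψ ι) (tOfArchType (archTypeOfRecord μω) ι)` whenever the ξ-family
  (★ `MemXiFamily`) contains a discrete `P` of (anti)holomorphic cotangent type at the CM frame — by central characters + weak approximation, no packets, no trace formula.
* NOT RESTATED HERE (gate rule `dedup.landed`, one home per statement): the ALL-PLACES forms.  With O-SPLIT ★, every theorem of ★ (B6)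
  `F0P3cXiCentralAllPlaces` (p850069, LH1-p01 (g4)) is unconditional by ONE application — e.g. CENTRAL-∀τ («`s2CentralAll`») is the term
  `F0P3cXiCentralAllPlaces.centralSum_eq_zero_at_of_split F0P3cXiCentralCharSplit.xiCentralCharSplit L ι H T hT hdef h2 μ μω hμu hμω P hP ξ hmem τ a b c habc
  : a + b + c = 0` at EVERY complex embedding `τ` (compact places included), and likewise `centralExponent_eq_zero_at_of_split xiCentralCharSplit …`
  (`3·qψ τ + 2·(pη τ + t_τ) + 1 = 0`), `isCohTrivialAt_of_split_of_qψ xiCentralCharSplit …` ∕ `isCohTrivialAt_iff_qψ_of_split xiCentralCharSplit …`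
  (PIN-τ ⇔ «`qψ τ = ±1`») and `sq_sum_eq_two_iff_qψ_of_split xiCentralCharSplit …` (CASIMIR-ι ⇔ «`qψ τ = ±1`»); consumers cite those ★ names with `xiCentralCharSplit`.

## References
* [Rogawski1990] J. Rogawski, *Automorphic representations of unitary groups in three variables*, Ann. of Math. Studies 123 (1990): Lemma 4.13.1 (b) p. 64, §12.2 p. 173,
  §12.3 pp. 174–178, §13.3 p. 201, §14.6 pp. 242–243.
* [PlatonovRapinchuk1994] V. Platonov, A. Rapinchuk, *Algebraic groups and number theory*, §7.3 (weak approximation for tori) — inside O-RIGID ★ p849942.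
* [Liu2021] Y. Liu, Camb. J. Math. 9 (2021), proof of Prop. 4.13 Case 1 («`χ_∞ = 1`») — inside O-ARCHψ.
* Tree: ★ (B0) `Theorems/F0P3cXiCentralIotaOfOrgans` (p850019), ★ SB5 `Theorems/F0P3cXiCentralCharSplit`, ★ (B6) `Theorems/F0P3cXiCentralAllPlaces` (p850069).
-/

set_option autoImplicit false

-- the mandated namespace has the single-problem summit's repeated segment (`HodgeConjecture.HodgeConjecture`)
set_option linter.dupNamespace false

noncomputable section

namespace Summit.HodgeConjecture.HodgeConjecture.Cruxes.H413.F0P3cXiCentralWeightZero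

open Summit.HodgeConjecture.HodgeConjecture.Cruxes.H413.F0P3cXiCentralIotaOfOrgans
open Summit.HodgeConjecture.HodgeConjecture.Cruxes.H413.F0P3cXiCentralCharSplit

/-! ## The head: CENTRAL-ι is a theorem -/

/-- **(B5) CENTRAL-ι «ZENTRUM» — `S2CentralIotaLetter` HOLDS**: for every CM field `L` (with `[L⁺:ℚ] ≥ 2`), CM frame `(ι, H, T)`, automorphic measure `μ`, unitary Hecke
character `μω` extending the quadratic CM character, every discrete automorphic `P` of `U(H)` of (anti)holomorphic cotangent type at the frame and every `ξ` with
`MemXiFamily P … μω hμu ξ`, the Rogawski triple `(a,b,c) = rogTriple (ξ.pη ι) (ξ.qψ ι) (tOfArchType (archTypeOfRecord μω) ι)` satisfies `a + b + c = 0`.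
Proof: the ★ (B0) head `s2CentralIota_of_organs` (central character `ψ_P` of `P` on `U(1)(𝔸)`, O-ARCHψ, O-SPLIT, O-RIGID, O-ARCH) with its one hypothesis O-SPLIT
discharged by ★ `xiCentralCharSplit`. [cite: Rogawski1990, §12.3 pp. 174–178; §13.3 p. 201] [cite: PlatonovRapinchuk1994, §7.3] -/
theorem s2CentralIota : S2CentralIotaLetter :=
  s2CentralIota_of_organs xiCentralCharSplit

end Summit.HodgeConjecture.HodgeConjecture.Cruxes.H413.F0P3cXiCentralWeightZero

end
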